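import Summits.SmoothPoincare4.SmoothPoincare4.Theses.SymplecticCap
import Literature.Geometry.Symplectic.AdjunctionEmbeddedSpheresReduction

/-!
# Birth skeleton — split piece X₁ `AdjunctionEmbeddedSpheres` (stmt-SmoothPoincare4-16775)

BC3 skeleton for the first piece of the typed split of crux `GromovRecognitionRelEnd`
(stmt-SmoothPoincare4-11009, route SymplecticCap; strategist seat cstrat-…-11009-r1).
The piece is Wendl 2018 Cor. 2.52 / Thm. 2.51 in two-chart form (= the Literature named fact
`Literature.Geometry.Symplectic.adjunction_embedded_of_somewhereInjective_sphere`, verbatim).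
Its plan is the fact seat's LANDED reduction
`Literature.Geometry.Symplectic.adjunction_embedded_of_somewhereInjective_sphere_of_parts`
(AdjunctionEmbeddedSpheresReduction.lean): the piece is the conjunction of two independent
published statements, which are the two registered stubs below —

* `stub_wendlEmbeddedness` (C1; Wendl 2020 Cor. 2.9 = Wendl 2018 Cor. 2.52, genus 0): a somewhere
  injective `J`-sphere whose glued map is homotopic to that of an EMBEDDED `J`-sphere is embedded
  (adjunction formula `[u]·[u] = 2δ(u) + c_N(u)`, `δ ≥ 0` with equality iff embedded; McDuff 1991,
  Micallef–White 1995 for non-immersed points). SIZE XL (no intersection theory of `J`-curves in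
  Mathlib). No normal-bundle hypothesis is needed for this half.
* `stub_normalWitnessTransfer` (C2; differential topology, Lee 2013 Thm. 6.24, Milnor–Stasheff §14):
  a trivial-normal-bundle witness (`N`, submersion `π` cutting the sphere out) transfers from an
  embedded two-chart sphere to any EMBEDDED two-chart sphere with homotopic glued map
  (`e(ν) = [Σ]·[Σ]` is homotopy invariant; oriented plane bundles over `S²` are classified by the
  Euler number; tubular neighbourhoods). SIZE L.

`AdjunctionEmbeddedSpheres_of` is the kernel-checked composition concluding the piece BY NAME from the
two stubs BY NAME (the landed glue; the route decl is the Literature fact, definitionally).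
Sorries: exactly the two stubs.
-/

namespace Summit.SmoothPoincare4.SmoothPoincare4.Cruxes.AdjunctionEmbeddedSpheres.Birth

open scoped Manifold ContDiff Topology
open Set Function Literature.Topology.FourManifolds Literature.Topology.FourManifolds.ComplexProjectiveSpace
open Literature.Geometry.Symplectic

/-- **Stub C1 (Wendl 2018 Cor. 2.52, genus 0; XL):** a somewhere injective `J`-sphere homotopic
(as glued maps `ℂP¹ → X`) to an embedded `J`-sphere is embedded. -/
theorem stub_wendlEmbeddedness :
    ∀ (X : Type) [TopologicalSpace X] [T2Space X] [SecondCountableTopology X]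
      [ChartedSpace (EuclideanSpace ℝ (Fin 4)) X] [IsManifold (𝓡 4) ∞ X]
      (JX : AlmostComplexStructure (𝓡 4) ∞ X) (u₀ v₀ u v : ℂ → X)
      (F F₀ : C(ComplexProjectiveSpace 1, X)),
      ContMDiff 𝓘(ℝ, ℂ) (𝓡 4) ∞ u₀ → ContMDiff 𝓘(ℝ, ℂ) (𝓡 4) ∞ v₀ → (∀ z : ℂ, z ≠ 0 → v₀ z = u₀ z⁻¹) →
      IsJHolomorphic (𝓡 4) (fun y => JX y) u₀ → IsJHolomorphic (𝓡 4) (fun y => JX y) v₀ →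
      Injective u₀ → (∀ z, Injective (mfderiv 𝓘(ℝ, ℂ) (𝓡 4) u₀ z)) →
      Injective (mfderiv 𝓘(ℝ, ℂ) (𝓡 4) v₀ 0) → v₀ 0 ∉ range u₀ →
      ContMDiff 𝓘(ℝ, ℂ) (𝓡 4) ∞ u → ContMDiff 𝓘(ℝ, ℂ) (𝓡 4) ∞ v → (∀ z : ℂ, z ≠ 0 → v z = u z⁻¹) →
      IsJHolomorphic (𝓡 4) (fun y => JX y) u → IsJHolomorphic (𝓡 4) (fun y => JX y) v →
      (∀ p, CoordNeZero 0 p → F p = u (affineCoordComplex 0 p 0)) →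
      (∀ p, CoordNeZero 1 p → F p = v (affineCoordComplex 1 p 0)) →
      (∀ p, CoordNeZero 0 p → F₀ p = u₀ (affineCoordComplex 0 p 0)) →
      (∀ p, CoordNeZero 1 p → F₀ p = v₀ (affineCoordComplex 1 p 0)) →
      F.Homotopic F₀ →
      (∃ z₀ : ℂ, Injective (mfderiv 𝓘(ℝ, ℂ) (𝓡 4) u z₀) ∧ (∀ z, u z = u z₀ → z = z₀) ∧ v 0 ≠ u z₀) →
      Injective u ∧ (∀ z, Injective (mfderiv 𝓘(ℝ, ℂ) (𝓡 4) u z)) ∧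
      Injective (mfderiv 𝓘(ℝ, ℂ) (𝓡 4) v 0) ∧ v 0 ∉ range u := by
  sorry

/-- **Stub C2 (transfer of a trivial-normal-bundle witness along a homotopy of embedded spheres;
L):** Lee 2013 Thm. 6.24 + Euler number of the normal bundle = self-intersection, a homotopy
invariant. -/
theorem stub_normalWitnessTransfer :
    ∀ (X : Type) [TopologicalSpace X] [T2Space X] [SecondCountableTopology X]
      [ChartedSpace (EuclideanSpace ℝ (Fin 4)) X] [IsManifold (𝓡 4) ∞ X]
      (_JX : AlmostComplexStructure (𝓡 4) ∞ X) (u₀ v₀ : ℂ → X) (N : Set X) (π : X → ℂ)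
      (u v : ℂ → X) (F F₀ : C(ComplexProjectiveSpace 1, X)),
      ContMDiff 𝓘(ℝ, ℂ) (𝓡 4) ∞ u₀ → ContMDiff 𝓘(ℝ, ℂ) (𝓡 4) ∞ v₀ → (∀ z : ℂ, z ≠ 0 → v₀ z = u₀ z⁻¹) →
      Injective u₀ → (∀ z, Injective (mfderiv 𝓘(ℝ, ℂ) (𝓡 4) u₀ z)) →
      Injective (mfderiv 𝓘(ℝ, ℂ) (𝓡 4) v₀ 0) → v₀ 0 ∉ range u₀ →
      IsOpen N → range u₀ ∪ {v₀ 0} ⊆ N → ContMDiffOn (𝓡 4) 𝓘(ℝ, ℂ) ∞ π N →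
      (∀ y ∈ N, Surjective (mfderiv (𝓡 4) 𝓘(ℝ, ℂ) π y)) →
      {y | y ∈ N ∧ π y = 0} = range u₀ ∪ {v₀ 0} →
      ContMDiff 𝓘(ℝ, ℂ) (𝓡 4) ∞ u → ContMDiff 𝓘(ℝ, ℂ) (𝓡 4) ∞ v → (∀ z : ℂ, z ≠ 0 → v z = u z⁻¹) →
      Injective u → (∀ z, Injective (mfderiv 𝓘(ℝ, ℂ) (𝓡 4) u z)) →
      Injective (mfderiv 𝓘(ℝ, ℂ) (𝓡 4) v 0) → v 0 ∉ range u →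
      (∀ p, CoordNeZero 0 p → F p = u (affineCoordComplex 0 p 0)) →
      (∀ p, CoordNeZero 1 p → F p = v (affineCoordComplex 1 p 0)) →
      (∀ p, CoordNeZero 0 p → F₀ p = u₀ (affineCoordComplex 0 p 0)) →
      (∀ p, CoordNeZero 1 p → F₀ p = v₀ (affineCoordComplex 1 p 0)) →
      F.Homotopic F₀ →
      ∃ (N' : Set X) (π' : X → ℂ), IsOpen N' ∧ range u ∪ {v 0} ⊆ N' ∧
      ContMDiffOn (𝓡 4) 𝓘(ℝ, ℂ) ∞ π' N' ∧ (∀ y ∈ N', Surjective (mfderiv (𝓡 4) 𝓘(ℝ, ℂ) π' y)) ∧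
      {y | y ∈ N' ∧ π' y = 0} = range u ∪ {v 0} := by
  sorry

/-- **Composition (kernel-checked, no sorry of its own): the piece BY NAME from the two stubs BY
NAME** — the landed glue `adjunction_embedded_of_somewhereInjective_sphere_of_parts` applied to
`stub_wendlEmbeddedness` (C1) and `stub_normalWitnessTransfer` (C2); the route decl
`SymplecticCap.AdjunctionEmbeddedSpheres` is the Literature fact verbatim (definitional). -/
theorem AdjunctionEmbeddedSpheres_of :
    Summit.SmoothPoincare4.SmoothPoincare4.Theses.SymplecticCap.AdjunctionEmbeddedSpheres :=
  adjunction_embedded_of_somewhereInjective_sphere_of_parts stub_wendlEmbeddedness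
    stub_normalWitnessTransfer

/-- The same term closes the Literature named fact (the route decl is this constant). -/
theorem adjunction_embedded_of_somewhereInjective_sphere_of_birth :
    adjunction_embedded_of_somewhereInjective_sphere :=
  AdjunctionEmbeddedSpheres_of

end Summit.SmoothPoincare4.SmoothPoincare4.Cruxes.AdjunctionEmbeddedSpheres.Birth
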